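import Summits.KontsevichZagierPeriods.KontsevichZagierPeriods.Theorems.GrothendieckSectorComplementRingJoin
import Summits.KontsevichZagierPeriods.KontsevichZagierPeriods.Theorems.GrothendieckGpcLegendreLemniscatic
import Summits.KontsevichZagierPeriods.KontsevichZagierPeriods.Theorems.GrothendieckKEAlgIndependent

/-!
# The lemniscatic sector kernel holds, and the remainder of route Grothendieck IS the Statement
# (target `LemniscaticSectorKernel`, stmt-KontsevichZagierPeriods-8598; read-back for the declared
# remainder `SectorComplement`, stmt-KontsevichZagierPeriods-11102, and its registered stub
# `stub_ringRemainder` of line `containment-join`)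

Route `KontsevichZagierPeriods/Grothendieck` (DIMENSION COUNT CLOSES SECTORS). Its three inputs are now
tree theorems:

* stmt-8611 `KEAlgIndependent` — `K(1/√2), E(1/√2)` algebraically independent over `ℚ`
  (`keAlgIndependent_proof`, Chudnovsky + Lawden);
* stmt-0280 `GpcLegendreLemniscatic` — Legendre's relation at `k² = 1/2` is move-accessible
  (`GpcLegendreLemniscatic_proof`, landed 2026-08-16);
* stmt-8612 `LemniscaticSectorGlue` — the dimension count
  `KEAlgIndependent → GpcLegendreLemniscatic → LemniscaticSectorKernel` (`lemniscaticSectorGlue_proof`).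

Hence:

* §1 **`lemniscaticSectorKernel_proof : LemniscaticSectorKernel`** (route target stmt-8598, rank 0):
  Conjecture 1 of Kontsevich–Zagier in kernel form on the whole sector ring `ℤ[K, E, π]` — every
  `ℤ`-combination of lemniscatic monomial representations with vanishing value is a relation;
* §2 the hypothesis of the registered stub `stub_ringRemainder` (injectivity of `evalP` on the ring join
  `ℤ[κ, ε, ϖ, W₂, W₄]`) is a THEOREM (`ringJoinKernel_holds`), so the stub, and the crux
  `SectorComplement` itself, are each EQUIVALENT to the Statement `KontsevichZagierPeriods`
  (`stub_ringRemainder_iff_summit`, `sectorComplement_iff_summit`) — unconditionally. This is the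
  kernel-checked kill criterion of `Cruxes/SectorComplement/STUB-PLAN-stub_ringRemainder.md` (§0, §5 KC0):
  no cell should attempt to close the stub short of proving Conjecture 1 itself.

No definitions, no named-fact hypotheses; axioms standard.

References: M. Kontsevich, D. Zagier, *Periods* (2001), §1.2 (Conjecture 1), §4.1; G. V. Chudnovsky,
*Contributions to the theory of transcendental numbers* (1984), Ch. 7; A. Huber, S. Müller-Stach,
*Periods and Nori Motives* (2017), §13.1.
-/

noncomputable section

open Set
open Literature.NumberTheory.Transcendental
open Literature.NumberTheory.Transcendental.KZ
open Summit.KontsevichZagierPeriods.KontsevichZagierPeriods.Theses.Grothendieck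
open Summit.KontsevichZagierPeriods.Grothendieck (keAlgIndependent_proof gpcZeta4Eq4zeta31_proof)
open Summit.KontsevichZagierPeriods.Grothendieck.GpcLegendreLemniscaticNegative (kRep eRep)
open Summit.KontsevichZagierPeriods.Grothendieck.LemniscaticSectorGlue (lemniscaticSectorGlue_proof)
open Summit.KontsevichZagierPeriods.Grothendieck.GpcLegendreLemniscaticLine (GpcLegendreLemniscatic_proof)
open Summit.KontsevichZagierPeriods.MzvKernelInKZ.Negative (genSetAdm)

namespace Summit.KontsevichZagierPeriods.Grothendieck.SectorComplementRingJoin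

/-! ## §1 The route target `LemniscaticSectorKernel` (stmt-KontsevichZagierPeriods-8598) -/

/-- **`LemniscaticSectorKernel` holds** (route target stmt-KontsevichZagierPeriods-8598, rank 0):
Conjecture 1 of Kontsevich–Zagier in kernel form on the lemniscatic sector ring `ℤ[K, E, π]` — every
finite `ℤ`-combination of lemniscatic monomial representations (types `(a, b, c)`) whose value vanishes
lies in `KZ.relations`. Proof: the dimension count `lemniscaticSectorGlue_proof` (stmt-8612) fed with
the two tree theorems `keAlgIndependent_proof` (stmt-8611: `K(1/√2), E(1/√2)` algebraically independent,
Chudnovsky) and `GpcLegendreLemniscatic_proof` (stmt-0280: Legendre's relation at `k² = 1/2` is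
move-accessible). [cite: KontsevichZagier2001, §1.2, §4.1] [cite: Chudnovsky1984, Ch. 7] -/
theorem lemniscaticSectorKernel_proof : LemniscaticSectorKernel :=
  lemniscaticSectorGlue_proof keAlgIndependent_proof GpcLegendreLemniscatic_proof

/-! ## §2 Read-back: the stub `stub_ringRemainder` and the crux `SectorComplement` ARE the Statement -/

/-- **The hypothesis of the registered stub `stub_ringRemainder` is a theorem**: `evalP` is injective
on the ring join `ℤ[κ, ε, ϖ, W₂, W₄]` (the lemniscatic classes `κ, ε`, any representation `ϖ` of `π`
on `ℝ`, and all admissible word classes of weights `2`, `4`) — `stub_ringJoin` fed with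
`lemniscaticSectorKernel_proof`. So the stub's antecedent is idle. [cite: KontsevichZagier2001, §1.2] -/
theorem ringJoinKernel_holds :
    ∀ (p : IntegralRep 1), p.domain = Set.univ → (p.integrand = fun x => 1 / (1 + x 0 ^ 2)) →
      ∀ x ∈ Subring.closure
          ({toFormalPeriod (of kRep), toFormalPeriod (of eRep), toFormalPeriod (of p)} ∪
            toFormalPeriod '' (genSetAdm 2 ∪ genSetAdm 4)),
        evalP x = 0 → x = 0 :=
  stub_ringJoin lemniscaticSectorKernel_proof

/-- **KILL CRITERION for the stub `stub_ringRemainder`** (line `containment-join`, crux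
stmt-KontsevichZagierPeriods-11102): the registered stub — "injectivity of `evalP` on the ring join
`ℤ[κ, ε, ϖ, W₂, W₄]` → Statement" — is EQUIVALENT to the Statement `KontsevichZagierPeriods`
(Conjecture 1 of Kontsevich–Zagier for all pairs of representations), unconditionally, because its
antecedent is the theorem `ringJoinKernel_holds`. Any sorry-free proof of the stub is a proof of the
period conjecture. [cite: KontsevichZagier2001, §1.2, Conjecture 1] -/
theorem stub_ringRemainder_iff_summit :
    ((∀ (p : IntegralRep 1), p.domain = Set.univ → (p.integrand = fun x => 1 / (1 + x 0 ^ 2)) →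
      ∀ x ∈ Subring.closure
          ({toFormalPeriod (of kRep), toFormalPeriod (of eRep), toFormalPeriod (of p)} ∪
            toFormalPeriod '' (genSetAdm 2 ∪ genSetAdm 4)),
        evalP x = 0 → x = 0) → KontsevichZagierPeriods) ↔ KontsevichZagierPeriods :=
  ⟨fun hrem => hrem ringJoinKernel_holds, fun hs _ => hs⟩

/-- **The crux `SectorComplement` IS the Statement**: both antecedents of
`SectorComplement := LemniscaticSectorKernel → GpcZeta4Eq4zeta31 → KontsevichZagierPeriods` are tree
theorems (`lemniscaticSectorKernel_proof`, `gpcZeta4Eq4zeta31_proof`), so the declared, NOT CLAIMED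
remainder of route Grothendieck is literally equivalent to `KontsevichZagierPeriods` — it relocates no
strength and carries none away. [cite: KontsevichZagier2001, §1.2, Conjecture 1] -/
theorem sectorComplement_iff_summit : SectorComplement ↔ KontsevichZagierPeriods :=
  ⟨fun h => h lemniscaticSectorKernel_proof gpcZeta4Eq4zeta31_proof, fun h _ _ => h⟩

end Summit.KontsevichZagierPeriods.Grothendieck.SectorComplementRingJoin

end
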